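import Mathlib
import Summits.NavierStokesRegularity.NavierStokesRegularity.Theorems.LerayQuarterDissipationFiniteDissipationLiouvilleAveragedPhysical
import Summits.NavierStokesRegularity.NavierStokesRegularity.Theorems.LerayQuarterDissipationFiniteDissipationLiouvilleAveragedPeriodic
import Summits.NavierStokesRegularity.NavierStokesRegularity.Theorems.LerayQuarterDissipationFiniteDissipationLiouvilleHardness
import HarnessLib

/-!
# Crux `FiniteDissipationLiouville` (stmt-NavierStokesRegularity-22144): THRESHOLD ONE ON AVERAGE,
# LAW-FREE — enveloped Type-I ancient fields (in particular Type-I DSS profiles, every factor) whose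
# scale-invariant velocity amplitude has small parabolic backward mean square, or small PERIOD mean
# square, vanish

Theorems file of route `LerayQuarterDissipation` (lead prover g16; `--supports` the crux; corollaries
of `…AveragedVelocity` / `…AveragedPhysical` / `…AveragedPeriodic` with the route's hardness bridge
`…Hardness`: a Type-I envelope `‖V(t,x)‖ ≤ C₀/(‖x‖+√(−t))` yields the quarter-rate law,
`Hardness.exists_dissipationLaw_of_hasTypeIDecay`). Navier–Stokes regularity is NOT proved by anything
here; no summit is.

The catalogued wall `TypeIDSSLiouville c` (Bradshaw–Tsai OP 5.1) concerns Type-I ancient mild fields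
WITH a Type-I envelope, discretely self-similar with factor `c`; the law-free small-constant Liouville
theorem T31⁗ kills those with `√(−t)‖V‖_∞ < 1`. Law-free averaged forms:

* `eq_zero_of_typeI_envelope_of_velocity_avg_lt` — enveloped Type-I ancient mild field, continuous
  majorant `‖U(σ,·)‖_∞ ≤ γ(σ)` of the similarity velocity with `∫_a^s e^{−(s−σ)/2}γ² ≤ Γ₂ < 2` for all
  `a ≤ s` ⇒ `V ≡ 0`;
* `eq_zero_of_typeI_envelope_of_velocity_physicalAvg_lt` — the same in physical time
  (`√(−t)‖V(t,x)‖ ≤ g(t)`, `∫_a^t √(−t)(−τ)^{−3/2}g² ≤ Γ₂ < 2`);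
* **`eq_zero_of_typeI_envelope_of_velocity_periodMean_lt`** — enveloped Type-I ancient mild field with
  a continuous `T`-PERIODIC majorant `γ` and `∫_0^T γ² < 2(1 − e^{−T/2})` ⇒ `V ≡ 0`; for a `c`-DSS
  profile (`T = 2 log c`, its natural period in similarity time) this is OP 5.1 on the sub-class
  «period mean square of the Type-I amplitude `< (1 − c⁻¹)/log c`», EVERY factor `c > 1`
  (`eq_zero_of_typeI_dss_of_velocity_periodMean_lt`, `e^{−log c} = c⁻¹`).

HONEST FRAMING. Restrictions of the catalogued open problem to explicit MEAN-smallness sub-classes; the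
wall for profiles with large mean amplitude stays OPEN; majorants are user-supplied continuous
functions; nothing here bears on Navier–Stokes regularity or blow-up.

References: Bradshaw–Tsai, Comm. PDE 42 (2017) OP 5.1; Koch–Nadirashvili–Seregin–Šverák 2009 §5;
Tsai 1998; folklore.
-/

noncomputable section

set_option linter.dupNamespace false

namespace Summit.NavierStokesRegularity.NavierStokesRegularity.Theorems.FiniteDissipationLiouville.Averaged

open MeasureTheory Set Filter Topology Metric Function Real
open scoped ENNReal
open Literature.Analysis Literature.Analysis.FluidPDE
open Summit.NavierStokesRegularity.NavierStokesRegularity.Theorems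
open Summit.NavierStokesRegularity.NavierStokesRegularity.Theorems.FiniteDissipationLiouville

variable {C C₀ : ℝ} {V : ℝ → EuclideanSpace ℝ (Fin 3) → EuclideanSpace ℝ (Fin 3)}

/-- **Threshold one on average, law-free.** An enveloped Type-I ancient mild field (`HasTypeIDecay C₀ V`)
whose similarity velocity has a continuous majorant `‖U(σ,y)‖ ≤ γ(σ)` (`γ ≥ 0`) with
`∫_a^s e^{−(s−σ)/2}γ(σ)²dσ ≤ Γ₂` for all `a ≤ s`, `Γ₂ < 2`, vanishes identically on `t < 0`.
[cite: KochNadirashviliSereginSverak2009, §4 (arXiv:0709.3599 p. 8)] -/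
theorem eq_zero_of_typeI_envelope_of_velocity_avg_lt (hV : IsTypeIAncientMild C V)
    (hdec : HasTypeIDecay C₀ V) {γ : ℝ → ℝ} (hγc : Continuous γ) (hγ0 : ∀ σ, 0 ≤ γ σ)
    (hU : ∀ σ y, ‖lerayOrbit V σ y‖ ≤ γ σ)
    {Γ₂ : ℝ} (hΓ : ∀ a s : ℝ, a ≤ s → ∫ σ in a..s, Real.exp (-((1 / 2) * (s - σ))) * γ σ ^ 2 ≤ Γ₂)
    (hΓlt : Γ₂ < 2) :
    ∀ t < 0, ∀ x, V t x = 0 := by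
  obtain ⟨K', hlaw⟩ := Hardness.exists_dissipationLaw_of_hasTypeIDecay hV hdec
  exact eq_zero_of_velocity_avg_lt hV hlaw hγc hγ0 hU hΓ hΓlt

/-- **Threshold one on average in physical time, law-free.** An enveloped Type-I ancient mild field
with a majorant `√(−t)‖V(t,x)‖ ≤ g(t)` (`g ≥ 0`, continuous on `t < 0`) and
`∫_a^t √(−t)/(√(−τ)(−τ)) g(τ)² dτ ≤ Γ₂ < 2` for all `a ≤ t < 0` vanishes identically on `t < 0`.
[cite: KochNadirashviliSereginSverak2009, §4 (arXiv:0709.3599 p. 8)] -/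
theorem eq_zero_of_typeI_envelope_of_velocity_physicalAvg_lt (hV : IsTypeIAncientMild C V)
    (hdec : HasTypeIDecay C₀ V) {g : ℝ → ℝ} (hgc : ContinuousOn g (Set.Iio 0))
    (hg0 : ∀ t : ℝ, t < 0 → 0 ≤ g t) (hVg : ∀ t : ℝ, t < 0 → ∀ x, Real.sqrt (-t) * ‖V t x‖ ≤ g t)
    {Γ₂ : ℝ} (hΓ : ∀ a t : ℝ, a ≤ t → t < 0 →
      ∫ τ in a..t, Real.sqrt (-t) / (Real.sqrt (-τ) * (-τ)) * g τ ^ 2 ≤ Γ₂)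
    (hΓlt : Γ₂ < 2) :
    ∀ t < 0, ∀ x, V t x = 0 := by
  obtain ⟨K', hlaw⟩ := Hardness.exists_dissipationLaw_of_hasTypeIDecay hV hdec
  exact eq_zero_of_velocity_physicalAvg_lt hV hlaw hgc hg0 hVg hΓ hΓlt

/-- **Threshold one with the PERIOD mean, law-free.** An enveloped Type-I ancient mild field whose
similarity velocity has a continuous `T`-periodic majorant `‖U(σ,y)‖ ≤ γ(σ)` (`T > 0`, `γ ≥ 0`) with
`∫_0^T γ² < 2(1 − e^{−T/2})` vanishes identically on `t < 0`. [cite: KochNadirashviliSereginSverak2009, §4 (arXiv:0709.3599 p. 8)] -/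
theorem eq_zero_of_typeI_envelope_of_velocity_periodMean_lt (hV : IsTypeIAncientMild C V)
    (hdec : HasTypeIDecay C₀ V) {γ : ℝ → ℝ} (hγc : Continuous γ) (hγ0 : ∀ σ, 0 ≤ γ σ) {T : ℝ}
    (hT : 0 < T) (hper : Function.Periodic γ T) (hU : ∀ σ y, ‖lerayOrbit V σ y‖ ≤ γ σ)
    (hmean : ∫ σ in (0 : ℝ)..T, γ σ ^ 2 < 2 * (1 - Real.exp (-(T / 2)))) :
    ∀ t < 0, ∀ x, V t x = 0 := by
  obtain ⟨K', hlaw⟩ := Hardness.exists_dissipationLaw_of_hasTypeIDecay hV hdec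
  exact eq_zero_of_velocity_periodMean_lt hV hlaw hγc hγ0 hT hper hU hmean

/-- **Bradshaw–Tsai OP 5.1 on the sub-class «period mean square of the Type-I amplitude below
`(1 − c⁻¹)/log c`», every factor.** A Type-I ancient mild field with a Type-I envelope, discretely
self-similar with factor `c > 1`, whose similarity velocity has a continuous `2 log c`-periodic
majorant `γ` (`2 log c` is the period of its similarity orbit) with `∫_0^{2 log c} γ² < 2(1 − c⁻¹)`,
vanishes identically (the self-similarity enters only through the period). [cite: KochNadirashviliSereginSverak2009, §4 (arXiv:0709.3599 p. 8)] -/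
theorem eq_zero_of_typeI_dss_of_velocity_periodMean_lt (hV : IsTypeIAncientMild C V)
    (hdec : HasTypeIDecay C₀ V) {c : ℝ} (hc : 1 < c) (_hdss : IsDiscretelySelfSimilar c V)
    {γ : ℝ → ℝ} (hγc : Continuous γ) (hγ0 : ∀ σ, 0 ≤ γ σ)
    (hper : Function.Periodic γ (2 * Real.log c)) (hU : ∀ σ y, ‖lerayOrbit V σ y‖ ≤ γ σ)
    (hmean : ∫ σ in (0 : ℝ)..(2 * Real.log c), γ σ ^ 2 < 2 * (1 - c⁻¹)) :
    ∀ t < 0, ∀ x, V t x = 0 := by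
  have hT : 0 < 2 * Real.log c := mul_pos two_pos (Real.log_pos hc)
  have hexp : Real.exp (-(2 * Real.log c / 2)) = c⁻¹ := by
    rw [show -(2 * Real.log c / 2) = -Real.log c by ring, Real.exp_neg, Real.exp_log (by linarith)]
  refine eq_zero_of_typeI_envelope_of_velocity_periodMean_lt hV hdec hγc hγ0 hT hper hU ?_
  rwa [hexp]

end Summit.NavierStokesRegularity.NavierStokesRegularity.Theorems.FiniteDissipationLiouville.Averaged

end
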